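import Summits.CriticalPhenomena.CardyFormulaZ2.Theorems.CardyBoundaryCoulombGasRectilinearCardyStubRowBlocksPart14
import Summits.CriticalPhenomena.CardyFormulaZ2.Theorems.CardyBoundaryCoulombGasRectilinearCardyStubRowBlocksPart15
import HarnessLib

/-!
# Stub B `stub_rowBlocks` of line `excursion-kernel-covariance`, part 16: the continuum data of a
# flat-marked conformal rectangle along an admissible window
# (crux `RectilinearCardy`, stmt-CriticalPhenomena-5660, route `CardyBoundaryCoulombGas`)

`rb_continuum` packages, for a conformal rectangle `R` with flat marks and an admissible range
`[σ, σ']`, every mesh-independent datum consumed by the two-block theorem `rb_main_blocks` (part 10),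
read on the REVERSED Jordan domain `D` (`∂D(t) = ∂R(m₀ + m₃ - t)`, part 13): an enlarged admissible
range `[σ₂, σ₂']` (`kwl_exists_admissible_enlarge`), the window frame `(ow, Hw)` and frames at the marks
`b = ∂D(tb)`, `a = ∂D(ta)`, `d = ∂D(td)` (`tb = m₀ + m₃ - m₁`, `ta = m₃`, `td = m₀ + 1`; `rb_frames`),
ONE radius `r` (`rb_radius`) and ONE parameter scale `θ` below all parameter gaps (`rb_theta`), the
scales `θ', ε₂, m₂` (`rb_scales`), the tangential signs (`rb_sign_window`, `rb_sign_mark`), the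
near-parameter and separation statements of `rb_radius`, the descriptions of the arcs `∂D([tb, ta])`
(`= R.arc 0`) and `∂D([td - 1, t₁])` near their ends as tangential half-lines
(`rb_arc_end_frame_left/right`), and the nonemptiness of their complements. Window statements are
given for every parameter `t₁` within `θ` of a reversed window point `m₀ + m₃ - τ`, `τ ∈ [σ, σ']`.

All [folklore].
-/

noncomputable section

open Set Metric
open Literature.Probability.RandomPlanarGeometry
open Literature.Probability.LatticeModels (Orient)

namespace Summit.CriticalPhenomena.CardyFormulaZ2.Cruxes.RectilinearCardy.ExcursionKernelCovariance

/-- **The continuum data of the ROW BLOCKS stub.** See the module docstring. [folklore] -/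
theorem rb_continuum (R : ConformalRectangle) (hFlat : FlatMarks R) {σ σ' : ℝ} (hadm : AdmissibleRange R σ σ') :
    ∃ (D : JordanDomain) (σ₂ σ₂' tb ta td : ℝ) (ow ob oa od : Orient) (Hw r θ θ' ε₂ m₂ sTw sTb sTa sTd : ℝ),
      D.carrier = R.carrier ∧ (∀ t : ℝ, D.boundary t = R.boundary (R.mark 0 + R.mark 3 - t)) ∧
      (tb = R.mark 0 + R.mark 3 - R.mark 1 ∧ ta = R.mark 3 ∧ td = R.mark 0 + 1) ∧
      (D.boundary tb = R.pt 1 ∧ D.boundary ta = R.pt 0 ∧ D.boundary td = R.pt 3) ∧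
      (R.mark 1 < σ₂ ∧ σ₂ < σ ∧ σ ≤ σ' ∧ σ' < σ₂' ∧ σ₂' < R.mark 3) ∧
      (0 < θ ∧ θ ≤ 1 ∧ 7 * θ ≤ σ - R.mark 1 ∧ 7 * θ ≤ R.mark 1 - R.mark 0 ∧ 7 * θ ≤ R.mark 0 + 1 - R.mark 3 ∧
        7 * θ ≤ R.mark 3 - σ') ∧
      (0 < r ∧ 0 < ε₂ ∧ 4 * ε₂ ≤ θ' ∧ θ' ≤ θ ∧ 0 < m₂ ∧ m₂ ≤ r / 4) ∧
      (∀ s t : ℝ, |s - t| ≤ 3 * θ' → dist (D.boundary s) (D.boundary t) < r / 16) ∧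
      (∀ s t : ℝ, (∀ n : ℤ, ε₂ ≤ |s - t - n|) → m₂ ≤ dist (D.boundary s) (D.boundary t)) ∧
      -- the window frame, read on `R`
      (∀ t ∈ Icc σ₂ σ₂', ∀ z, dist z (R.boundary t) < r → (z ∈ closure R.carrier ↔ Hw ≤ Orient.nrmC ow z)) ∧
      (∀ t ∈ Icc σ₂ σ₂', ∀ z, dist z (R.boundary t) < r → (z ∈ R.carrier ↔ Hw < Orient.nrmC ow z)) ∧
      -- frames at the marks
      ((∀ z, dist z (D.boundary tb) < r → (z ∈ closure D.carrier ↔ Orient.nrmC ob (D.boundary tb) ≤ Orient.nrmC ob z)) ∧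
        (∀ z, dist z (D.boundary tb) < r → (z ∈ D.carrier ↔ Orient.nrmC ob (D.boundary tb) < Orient.nrmC ob z))) ∧
      ((∀ z, dist z (D.boundary ta) < r → (z ∈ closure D.carrier ↔ Orient.nrmC oa (D.boundary ta) ≤ Orient.nrmC oa z)) ∧
        (∀ z, dist z (D.boundary ta) < r → (z ∈ D.carrier ↔ Orient.nrmC oa (D.boundary ta) < Orient.nrmC oa z))) ∧
      ((∀ z, dist z (D.boundary td) < r → (z ∈ closure D.carrier ↔ Orient.nrmC od (D.boundary td) ≤ Orient.nrmC od z)) ∧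
        (∀ z, dist z (D.boundary td) < r → (z ∈ D.carrier ↔ Orient.nrmC od (D.boundary td) < Orient.nrmC od z))) ∧
      -- tangential signs at the marks
      ((sTw = 1 ∨ sTw = -1) ∧ (sTb = 1 ∨ sTb = -1) ∧ (sTa = 1 ∨ sTa = -1) ∧ (sTd = 1 ∨ sTd = -1)) ∧
      (∀ t t' : ℝ, |t - tb| ≤ 2 * θ → |t' - tb| ≤ 2 * θ → t < t' → 0 < sTb * (Orient.tngC ob (D.boundary t') - Orient.tngC ob (D.boundary t))) ∧
      (∀ t t' : ℝ, |t - ta| ≤ 2 * θ → |t' - ta| ≤ 2 * θ → t < t' → 0 < sTa * (Orient.tngC oa (D.boundary t') - Orient.tngC oa (D.boundary t))) ∧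
      (∀ t t' : ℝ, |t - td| ≤ 2 * θ → |t' - td| ≤ 2 * θ → t < t' → 0 < sTd * (Orient.tngC od (D.boundary t') - Orient.tngC od (D.boundary t))) ∧
      -- separations and arcs at the marks
      (r ≤ dist (D.boundary tb) (D.boundary ta) ∧ r ≤ dist (D.boundary ta) (D.boundary td) ∧ r ≤ dist (D.boundary tb) (D.boundary td)) ∧
      (∀ z ∈ frontier D.carrier, dist z (D.boundary tb) < r →
        (z ∈ D.boundary '' Icc tb ta ↔ 0 ≤ ((1 : ℤ) : ℝ) * sTb * (Orient.tngC ob z - Orient.tngC ob (D.boundary tb)))) ∧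
      (∀ z ∈ frontier D.carrier, dist z (D.boundary ta) < r →
        (z ∈ D.boundary '' Icc tb ta ↔ 0 ≤ ((-1 : ℤ) : ℝ) * sTa * (Orient.tngC oa z - Orient.tngC oa (D.boundary ta)))) ∧
      (frontier D.carrier \ D.boundary '' Icc tb ta).Nonempty ∧
      -- the window: every parameter `t₁` within `θ` of a reversed window point
      (∀ τ ∈ Icc σ σ', ∀ t₁ : ℝ, |t₁ - (R.mark 0 + R.mark 3 - τ)| ≤ θ →
        Orient.nrmC ow (D.boundary t₁) = Hw ∧
        (∀ z, dist z (D.boundary t₁) < r → (z ∈ closure D.carrier ↔ Hw ≤ Orient.nrmC ow z)) ∧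
        (∀ z, dist z (D.boundary t₁) < r → (z ∈ D.carrier ↔ Hw < Orient.nrmC ow z)) ∧
        (∀ t t' : ℝ, |t - t₁| ≤ 2 * θ → |t' - t₁| ≤ 2 * θ → t < t' →
          0 < sTw * (Orient.tngC ow (D.boundary t') - Orient.tngC ow (D.boundary t))) ∧
        (∀ z ∈ frontier D.carrier, dist z (D.boundary t₁) < r → ∃ t, |t - t₁| ≤ θ ∧ D.boundary t = z) ∧
        (r ≤ dist (D.boundary tb) (D.boundary t₁) ∧ r ≤ dist (D.boundary ta) (D.boundary t₁) ∧ r ≤ dist (D.boundary td) (D.boundary t₁)) ∧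
        (∀ z ∈ frontier D.carrier, dist z (D.boundary td) < r →
          (z ∈ D.boundary '' Icc (td - 1) t₁ ↔ 0 ≤ ((1 : ℤ) : ℝ) * sTd * (Orient.tngC od z - Orient.tngC od (D.boundary td)))) ∧
        (∀ z ∈ frontier D.carrier, dist z (D.boundary t₁) < r →
          (z ∈ D.boundary '' Icc (td - 1) t₁ ↔ 0 ≤ -sTw * (Orient.tngC ow z - Orient.tngC ow (D.boundary t₁)))) ∧
        (frontier D.carrier \ D.boundary '' Icc (td - 1) t₁).Nonempty ∧
        R.mark 0 + R.mark 3 - t₁ ∈ Ioo σ₂ σ₂') := by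
  -- the reversed domain and the enlarged window
  obtain ⟨D, hDc, hDb⟩ := rb_reverse R
  have hadm' := hadm
  obtain ⟨h1, hσσ', h3, -⟩ := hadm'
  obtain ⟨σ₂, σ₂', hadm₂, hσ₂, hσ₂'⟩ := kwl_exists_admissible_enlarge R hadm le_rfl hσσ' le_rfl
  have h1₂ : R.mark 1 < σ₂ := hadm₂.1
  have h3₂ : σ₂' < R.mark 3 := hadm₂.2.2.1
  have h0 := (R.mark_mem 0).1
  have h01 : R.mark 0 < R.mark 1 := R.strictMono_mark (show (0 : Fin 4) < 1 by decide)
  have h31 := (R.mark_mem 3).2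
  -- frames
  obtain ⟨ow, ob, oa, od, Hw, rf, hrf, hwin, ⟨hclb, hopb⟩, ⟨hcla, hopa⟩, ⟨hcld, hopd⟩, hb, ha, hd⟩ :=
    rb_frames R D hDc hDb hFlat hadm₂
  -- one parameter scale below all gaps
  obtain ⟨θ, hθ, hθg, hmove⟩ := rb_theta D hrf (g := min (min ((σ - σ₂) / 3) ((σ₂' - σ') / 3))
    (min (min ((σ - R.mark 1) / 7) ((R.mark 1 - R.mark 0) / 7)) (min ((R.mark 0 + 1 - R.mark 3) / 7) ((R.mark 3 - σ') / 7))))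
    (lt_min (lt_min (by linarith) (by linarith)) (lt_min (lt_min (by linarith) (by linarith)) (lt_min (by linarith) (by linarith))))
  have hθ₁ : 3 * θ ≤ σ - σ₂ := by
    have h := hθg.trans (min_le_of_left_le (min_le_left _ _)); linarith
  have hθ₂ : 3 * θ ≤ σ₂' - σ' := by
    have h := hθg.trans (min_le_of_left_le (min_le_right _ _)); linarith
  have hθ₃ : 7 * θ ≤ σ - R.mark 1 := by
    have h := hθg.trans (min_le_of_right_le (min_le_of_left_le (min_le_left _ _))); linarith
  have hθ₄ : 7 * θ ≤ R.mark 1 - R.mark 0 := by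
    have h := hθg.trans (min_le_of_right_le (min_le_of_left_le (min_le_right _ _))); linarith
  have hθ₅ : 7 * θ ≤ R.mark 0 + 1 - R.mark 3 := by
    have h := hθg.trans (min_le_of_right_le (min_le_of_right_le (min_le_left _ _))); linarith
  have hθ₆ : 7 * θ ≤ R.mark 3 - σ' := by
    have h := hθg.trans (min_le_of_right_le (min_le_of_right_le (min_le_right _ _))); linarith
  have h4θ : 4 * θ < 1 := by linarith
  have hθ1 : θ ≤ 1 := by linarith
  -- tangential signs
  obtain ⟨sTw, hsTw, hTw⟩ := rb_sign_window R D hDb h1₂ hadm₂.2.1 h3₂ (fun t ht => (hwin t ht).1)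
  obtain ⟨sTb, hsTb, hTb⟩ := rb_sign_mark D hθ h4θ hclb hopb hmove
  obtain ⟨sTa, hsTa, hTa⟩ := rb_sign_mark D hθ h4θ hcla hopa hmove
  obtain ⟨sTd, hsTd, hTd⟩ := rb_sign_mark D hθ h4θ hcld hopd hmove
  -- one radius
  obtain ⟨r, hr, hrrf, hnb, hna, hnd, hnw, hsepw, hsba, hsad, hsbd⟩ :=
    rb_radius D (w₁ := R.mark 0 + R.mark 3 - σ₂' + 2 * θ) (w₁' := R.mark 0 + R.mark 3 - σ₂ - 2 * θ)
      (w₂ := R.mark 0 + R.mark 3 - σ₂') (w₂' := R.mark 0 + R.mark 3 - σ₂)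
      (tb := R.mark 0 + R.mark 3 - R.mark 1) (ta := R.mark 3) (td := R.mark 0 + 1)
      hrf hθ (by linarith) (by linarith) (by linarith) ⟨by linarith, by linarith, by linarith, by linarith⟩
      hwin hclb hopb hcla hopa hcld hopd hmove hsTw hsTb hsTa hsTd hTw hTb hTa hTd
  -- scales
  obtain ⟨θ', ε₂, m₂, hε₂, hε₂θ', hθ'θ, hunif, hm₂, hm₂r, htube⟩ := rb_scales D hr hθ hθ1
  -- the window frame read on `R`, radius `r`
  have hwinR : ∀ t ∈ Icc σ₂ σ₂', (∀ z, dist z (R.boundary t) < r → (z ∈ closure R.carrier ↔ Hw ≤ Orient.nrmC ow z)) ∧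
      (∀ z, dist z (R.boundary t) < r → (z ∈ R.carrier ↔ Hw < Orient.nrmC ow z)) := by
    intro t ht
    obtain ⟨-, hcl, hop⟩ := hwin (R.mark 0 + R.mark 3 - t) ⟨by linarith [ht.2], by linarith [ht.1]⟩
    have e : D.boundary (R.mark 0 + R.mark 3 - t) = R.boundary t := by
      rw [hDb, show R.mark 0 + R.mark 3 - (R.mark 0 + R.mark 3 - t) = t by ring]
    rw [e, hDc] at hcl hop
    exact ⟨fun z hz => hcl z (lt_of_lt_of_le hz hrrf), fun z hz => hop z (lt_of_lt_of_le hz hrrf)⟩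
  -- arcs at the marks
  have hlenba : R.mark 3 - (R.mark 0 + R.mark 3 - R.mark 1) ≤ 1 - 2 * θ := by linarith
  have hAb := rb_arc_end_frame_left D (o := ob) (sT := sTb) (ρ := r) (α := R.mark 0 + R.mark 3 - R.mark 1) (β := R.mark 3)
    (ε := 2 * θ) (θ := 2 * θ) (by linarith) hlenba le_rfl hTb (rb_near_weaken D hθ hnb)
  have hAa := rb_arc_end_frame_right D (o := oa) (sT := sTa) (ρ := r) (α := R.mark 0 + R.mark 3 - R.mark 1) (β := R.mark 3)
    (ε := 2 * θ) (θ := 2 * θ) (by linarith) hlenba le_rfl hTa (rb_near_weaken D hθ hna)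
  have etd : D.boundary (R.mark 0 + 1 - 1) = D.boundary (R.mark 0 + 1) := by
    have := D.periodic_boundary (R.mark 0 + 1 - 1); rw [sub_add_cancel] at this; exact this.symm
  refine ⟨D, σ₂, σ₂', R.mark 0 + R.mark 3 - R.mark 1, R.mark 3, R.mark 0 + 1, ow, ob, oa, od, Hw, r, θ, θ', ε₂, m₂,
    sTw, sTb, sTa, sTd, hDc, hDb, ⟨rfl, rfl, rfl⟩, ⟨hb, ha, hd⟩, ⟨h1₂, by linarith, hσσ', by linarith, h3₂⟩,
    ⟨hθ, hθ1, hθ₃, hθ₄, hθ₅, hθ₆⟩, ⟨hr, hε₂, hε₂θ', hθ'θ, hm₂, hm₂r⟩, hunif, htube,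
    fun t ht => (hwinR t ht).1, fun t ht => (hwinR t ht).2,
    ⟨fun z hz => hclb z (lt_of_lt_of_le hz hrrf), fun z hz => hopb z (lt_of_lt_of_le hz hrrf)⟩,
    ⟨fun z hz => hcla z (lt_of_lt_of_le hz hrrf), fun z hz => hopa z (lt_of_lt_of_le hz hrrf)⟩,
    ⟨fun z hz => hcld z (lt_of_lt_of_le hz hrrf), fun z hz => hopd z (lt_of_lt_of_le hz hrrf)⟩,
    ⟨hsTw, hsTb, hsTa, hsTd⟩, hTb, hTa, hTd, ⟨hsba, hsad, hsbd⟩, fun z hz hzd => ?_, fun z hz hzd => ?_,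
    rb_compl_arc_nonempty D (γ := R.mark 0 + 1) (by linarith) (by linarith), fun τ hτ t₁ ht₁ => ?_⟩
  · rw [hAb z hz hzd, Int.cast_one, one_mul]
  · rw [hAa z hz hzd, show ((-1 : ℤ) : ℝ) * sTa = -sTa by push_cast; ring]
  -- the window clauses at `t₁`
  rw [abs_le] at ht₁
  have ht₁w : t₁ ∈ Icc (R.mark 0 + R.mark 3 - σ₂' + 2 * θ) (R.mark 0 + R.mark 3 - σ₂ - 2 * θ) :=
    ⟨by linarith [hτ.2], by linarith [hτ.1]⟩
  have ht₁w₂ : t₁ ∈ Icc (R.mark 0 + R.mark 3 - σ₂') (R.mark 0 + R.mark 3 - σ₂) := ⟨by linarith [hτ.2], by linarith [hτ.1]⟩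
  obtain ⟨hH, hcl, hop⟩ := hwin t₁ ht₁w₂
  have hTloc : ∀ t t' : ℝ, |t - t₁| ≤ 2 * θ → |t' - t₁| ≤ 2 * θ → t < t' →
      0 < sTw * (Orient.tngC ow (D.boundary t') - Orient.tngC ow (D.boundary t)) := by
    intro t t' ht ht' htt'
    rw [abs_le] at ht ht'
    exact hTw t ⟨by linarith [ht₁w.1], by linarith [ht₁w.2]⟩ t' ⟨by linarith [ht₁w.1], by linarith [ht₁w.2]⟩ htt'
  have hlen : t₁ - (R.mark 0 + 1 - 1) ≤ 1 - 2 * θ := by linarith [hτ.1]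
  have hAd := rb_arc_end_frame_left D (o := od) (sT := sTd) (ρ := r) (α := R.mark 0 + 1 - 1) (β := t₁)
    (ε := 2 * θ) (θ := 2 * θ) (by linarith [hτ.2]) hlen le_rfl (rb_sign_shift D hTd) (rb_near_shift D hθ hnd)
  have hAw := rb_arc_end_frame_right D (o := ow) (sT := sTw) (ρ := r) (α := R.mark 0 + 1 - 1) (β := t₁)
    (ε := 2 * θ) (θ := 2 * θ) (by linarith [hτ.2]) hlen le_rfl hTloc (rb_near_weaken D hθ (hnw t₁ ht₁w))
  rw [etd] at hAd
  refine ⟨hH, fun z hz => hcl z (lt_of_lt_of_le hz hrrf), fun z hz => hop z (lt_of_lt_of_le hz hrrf), hTloc, hnw t₁ ht₁w,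
    hsepw t₁ ht₁w, fun z hz hzd => ?_, hAw, rb_compl_arc_nonempty D (γ := R.mark 0 + R.mark 3 - R.mark 1)
      (by linarith [hτ.1]) (by linarith), ⟨by linarith [hτ.1], by linarith [hτ.2]⟩⟩
  rw [hAd z hz hzd, Int.cast_one, one_mul]

end Summit.CriticalPhenomena.CardyFormulaZ2.Cruxes.RectilinearCardy.ExcursionKernelCovariance

end
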